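import Summits.CriticalPhenomena.PercolationContinuityZ3.Theorems.PercNearOneGluingNoHeavyLowerTailKnQuestion8CoefficientwiseNCStarCycleFlip
import Summits.CriticalPhenomena.PercolationContinuityZ3.Theorems.PercNearOneGluingNoHeavyLowerTailKnQuestion8CoefficientwiseDominationPairing
import HarnessLib

/-!
# NC-DOWN on every cycle: every `(M,Z)`-antitone event has a nonnegative `T`-sum — prim-lf-2 gen 65, part 4

Support file (`--supports stmt-CriticalPhenomena-4575`, closed), prover `prim-lf-2` (gen 65).  No definitions, no named facts, no sorries; standard axioms.
Memo `prim-lf-2/CW-NCDOWN-gen65.md` §2 (CONJECTURE NC-DOWN) and §4 (cycles).  Parts 1–3: `…NCStarCycleClusters`, `…NCStarCycleFlip`, `…NCStarCycle` (`nca_cycle`).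

CONJECTURE NC-DOWN (prim-lf-2 gen 65): for every finite multigraph, root `x`, monotone `f, g` and every predicate `D` on pairs of vertex sets that is ANTITONE
(`D M Z → M' ⊆ M → Z' ⊆ Z → D M' Z'`), `0 ≤ Σ_{s : D (K s ∪ B s) (K s ∩ B s)} (f (K s) − f (B s))(g (K s) − g (B s))` (`K s = C_x(s)`, `B s = C_x(E∖s)`); equivalently every
down-set of the footprint/core poset `(M, Z)` carries a nonnegative block sum, equivalently (max-flow duality) every deficit block is paid from blocks below it.  It contains
NCA / NC* / NO-CORE / `(I1)_X` (`D M Z := X ∩ M = ∅ ∧ W ∩ Z = ∅`).  Exact for all rooted graphs on ≤ 5 vertices, heuristic census n = 6 (memo §2).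
* `Coefficientwise.ncDown_cycle` — **THEOREM: NC-DOWN holds on every cycle**, for every root and every antitone `D`.  Same dominating injection as `nca_cycle`: the
  red–blue flip preserves the footprint `M` and shrinks the core to `{x}`, so it stays inside every antitone event.
[cite: KozmaNitzan2024, Questions 8–9 (§5.5 p. 36) (context: the Question-8 pocket covariance programme)]
-/

namespace Summit.CriticalPhenomena.PercolationContinuityZ3.Theorems

open Finset Literature.Probability.Percolation

namespace Coefficientwise

variable {ι V : Type*} [DecidableEq ι]

open Classical in
/-- **NC-DOWN on every cycle.**  Cycle data: a closed vertex sequence `w 0 = x, …, w L = x` (`L ≥ 2`, `w` injective on `[0,L)`), edges `e 1, …, e L`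
(injective) with `ends (e t) = s(w (t−1), w t)`, `E` their set.  Then for every predicate `D` on pairs of vertex sets that is antitone in both arguments and all monotone
`f, g`: `0 ≤ Σ_{s ⊆ E : D (C_x s ∪ C_x(E∖s)) (C_x s ∩ C_x(E∖s))} (f (C_x s) − f (C_x(E∖s)))(g (C_x s) − g (C_x(E∖s)))`.
[cite: KozmaNitzan2024, Questions 8–9 (§5.5 p. 36) (context)] -/
theorem ncDown_cycle (ends : ι → Sym2 V) (L : ℕ) (w : ℕ → V) (e : ℕ → ι) (x : V) (E : Finset ι) (hL : 2 ≤ L)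
    (hw0 : w 0 = x) (hwL : w L = x) (hwinj : ∀ i j, i < L → j < L → w i = w j → i = j)
    (he : ∀ t, 1 ≤ t → t ≤ L → ends (e t) = s(w (t - 1), w t))
    (heinj : ∀ t t', 1 ≤ t → t ≤ L → 1 ≤ t' → t' ≤ L → e t = e t' → t = t')
    (hE : ∀ i, i ∈ E ↔ ∃ t, 1 ≤ t ∧ t ≤ L ∧ e t = i)
    (D : Set V → Set V → Prop) (hD : ∀ M Z M' Z', D M Z → M' ⊆ M → Z' ⊆ Z → D M' Z')
    (f g : Set V → ℝ) (hf : Monotone f) (hg : Monotone g) :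
    0 ≤ ∑ s ∈ E.powerset.filter (fun s : Finset ι =>
          D (openCluster (ends '' (↑s : Set ι)) x ∪ openCluster (ends '' (↑(E \ s) : Set ι)) x)
            (openCluster (ends '' (↑s : Set ι)) x ∩ openCluster (ends '' (↑(E \ s) : Set ι)) x)),
      (f (openCluster (ends '' (↑s : Set ι)) x) - f (openCluster (ends '' (↑(E \ s) : Set ι)) x)) *
        (g (openCluster (ends '' (↑s : Set ι)) x) - g (openCluster (ends '' (↑(E \ s) : Set ι)) x)) := by
  set K : Finset ι → Set V := fun s => openCluster (ends '' (↑s : Set ι)) x with hK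
  set Ev := E.powerset.filter (fun s : Finset ι => D (K s ∪ K (E \ s)) (K s ∩ K (E \ s))) with hEv
  change 0 ≤ ∑ s ∈ Ev, (f (K s) - f (K (E \ s))) * (g (K s) - g (K (E \ s)))
  have hxK : ∀ s : Finset ι, x ∈ K s := fun s => mem_openCluster_self _ x
  have mem_Ev : ∀ s, s ∈ Ev ↔ s ⊆ E ∧ D (K s ∪ K (E \ s)) (K s ∩ K (E \ s)) := by
    intro s; simp only [hEv, Finset.mem_filter, Finset.mem_powerset]
  -- cycle facts
  have heE : ∀ t, 1 ≤ t → t ≤ L → e t ∈ E := fun t h1 h2 => (hE _).mpr ⟨t, h1, h2, rfl⟩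
  have runs := fun (s : Finset ι) (hs : s ⊆ E) => cycle_openCluster_subset_runs ends L w e x E hw0 hwL hwinj he hE s hs
  -- colourings whose two root edges have the same colour are comparable
  have trivial_of_same : ∀ s, s ⊆ E → e 1 ∉ s → e L ∉ s → K s ⊆ {x} := by
    intro s hs h1 h2 v hv
    obtain ⟨j, hj, rfl, hrun⟩ := runs s hs hv
    rcases hrun with h | h
    · by_cases hj0 : j = 0
      · rw [hj0, hw0]; rfl
      · exact absurd (h 1 le_rfl (by omega)) h1
    · by_cases hjL : j = L
      · rw [hjL, hwL]; rfl
      · exact absurd (h L (by omega) le_rfl) h2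
  have memEs : ∀ s : Finset ι, ∀ t, 1 ≤ t → t ≤ L → (e t ∈ E \ s ↔ e t ∉ s) := by
    intro s t h1 h2; rw [Finset.mem_sdiff]; exact ⟨fun h => h.2, fun h => ⟨heE t h1 h2, h⟩⟩
  have hEss : ∀ s : Finset ι, s ⊆ E → E \ (E \ s) = s := fun s hs => Finset.sdiff_sdiff_eq_self hs
  -- incomparable ⇒ exactly one of `e 1`, `e L` is red
  have mixed : ∀ s, s ⊆ E → ¬ (K s ⊆ K (E \ s)) → ¬ (K (E \ s) ⊆ K s) → ((e 1 ∈ s ∧ e L ∉ s) ∨ (e 1 ∉ s ∧ e L ∈ s)) := by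
    intro s hs h1 h2
    by_cases ha : e 1 ∈ s <;> by_cases hb : e L ∈ s
    · exfalso; apply h2
      have := trivial_of_same (E \ s) Finset.sdiff_subset (fun h => (Finset.mem_sdiff.mp h).2 ha) (fun h => (Finset.mem_sdiff.mp h).2 hb)
      exact fun v hv => by rw [Set.mem_singleton_iff.mp (this hv)]; exact hxK s
    · exact Or.inl ⟨ha, hb⟩
    · exact Or.inr ⟨ha, hb⟩
    · exfalso; apply h1
      have := trivial_of_same s hs ha hb
      exact fun v hv => by rw [Set.mem_singleton_iff.mp (this hv)]; exact hxK (E \ s)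
  -- run lengths and the flip as functions of the colouring
  -- (`Nat.findGreatest` with the classical instance fixed once, so that its API lemmas apply verbatim)
  set P : Finset ι → ℕ := fun s => @Nat.findGreatest (fun j => ∀ t, 1 ≤ t → t ≤ j → e t ∈ s) (fun _ => Classical.propDecidable _) L with hP
  set Q : Finset ι → ℕ := fun s => @Nat.findGreatest (fun q => ∀ t, L - q < t → t ≤ L → e t ∉ s) (fun _ => Classical.propDecidable _) L with hQ
  set φ : Finset ι → Finset ι := fun s =>
    (s ∪ E.filter (fun i => ∃ t, L - Q s < t ∧ t ≤ L ∧ e t = i)).erase (e (max (L - Q s) (P s + 1))) with hφ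
  set Φ : Finset ι → Finset ι := fun s => if e 1 ∈ s then φ s else E \ φ (E \ s) with hΦ
  -- the flip package for red–blue colourings
  have pack : ∀ s, s ⊆ E → e 1 ∈ s → e L ∉ s → ¬ (K (E \ s) ⊆ K s) →
      (φ s ⊆ E ∧ e 1 ∈ φ s ∧
      (∀ j, j ≤ L → ((∀ t, 1 ≤ t → t ≤ j → e t ∈ φ s) ↔ j ≤ P s)) ∧
      (e (max (L - Q s) (P s + 1)) ∉ φ s ∧ ∀ t, max (L - Q s) (P s + 1) < t → t ≤ L → e t ∈ φ s) ∧
      (K s ∪ K (E \ s) ⊆ K (φ s)) ∧ (K (φ s) ⊆ K s ∪ K (E \ s)) ∧ (K (E \ φ s) ⊆ {x}) ∧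
      (∀ t, 1 ≤ t → t ≤ L → (e t ∈ s ↔ (t ≤ P s ∨ (P s < t ∧ t < max (L - Q s) (P s + 1) ∧ e t ∈ φ s) ∨
        (t = max (L - Q s) (P s + 1) ∧ max (L - Q s) (P s + 1) ≠ P s + 1))))) ∧
      max (L - Q s) (P s + 1) ≤ L := by
    intro s hs h1 hL' hBK
    -- the red prefix length `P s`
    have hPspec : ∀ t, 1 ≤ t → t ≤ P s → e t ∈ s :=
      @Nat.findGreatest_spec 0 (fun j => ∀ t, 1 ≤ t → t ≤ j → e t ∈ s) (fun _ => Classical.propDecidable _) L (Nat.zero_le L)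
        (fun t h1 h0 => by omega)
    have hPle : P s ≤ L := @Nat.findGreatest_le (fun j => ∀ t, 1 ≤ t → t ≤ j → e t ∈ s) (fun _ => Classical.propDecidable _) L
    have hP1 : 1 ≤ P s :=
      @Nat.le_findGreatest 1 (fun j => ∀ t, 1 ≤ t → t ≤ j → e t ∈ s) (fun _ => Classical.propDecidable _) L (by omega)
        (fun t ht1 ht2 => by
          have : t = 1 := by omega
          rw [this]; exact h1)
    have hPL : P s + 1 ≤ L := by
      rcases Nat.lt_or_ge (P s) L with h | h
      · omega
      · exfalso; exact hL' (hPspec L (by omega) (by omega))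
    have hP' : e (P s + 1) ∉ s := by
      intro h
      have : P s + 1 ≤ P s :=
        @Nat.le_findGreatest (P s + 1) (fun j => ∀ t, 1 ≤ t → t ≤ j → e t ∈ s) (fun _ => Classical.propDecidable _) L hPL
          (fun t ht1 ht2 => by
            by_cases htt : t = P s + 1
            · rw [htt]; exact h
            · exact hPspec t ht1 (by omega))
      omega
    -- the blue suffix length `Q s`
    have hQspec : ∀ t, L - Q s < t → t ≤ L → e t ∉ s :=
      @Nat.findGreatest_spec 0 (fun q => ∀ t, L - q < t → t ≤ L → e t ∉ s) (fun _ => Classical.propDecidable _) L (Nat.zero_le L)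
        (fun t h1 h0 => by omega)
    have hQle : Q s ≤ L := @Nat.findGreatest_le (fun q => ∀ t, L - q < t → t ≤ L → e t ∉ s) (fun _ => Classical.propDecidable _) L
    have hQ1 : 1 ≤ Q s :=
      @Nat.le_findGreatest 1 (fun q => ∀ t, L - q < t → t ≤ L → e t ∉ s) (fun _ => Classical.propDecidable _) L (by omega)
        (fun t ht1 ht2 => by
          have : t = L := by omega
          rw [this]; exact hL')
    have hQL : Q s + 1 ≤ L := by
      rcases Nat.lt_or_ge (Q s) L with h | h
      · omega
      · exfalso; exact hQspec 1 (by omega) (by omega) h1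
    have hQ' : e (L - Q s) ∈ s := by
      by_contra h
      have : Q s + 1 ≤ Q s :=
        @Nat.le_findGreatest (Q s + 1) (fun q => ∀ t, L - q < t → t ≤ L → e t ∉ s) (fun _ => Classical.propDecidable _) L hQL
          (fun t ht1 ht2 => by
            by_cases htt : t = L - Q s
            · rw [htt]; exact h
            · exact hQspec t (by omega) ht2)
      omega
    -- incomparability excludes the degenerate full-cover case `P s = L - 1`
    have hpq : P s + Q s = L → P s + 2 ≤ L := by
      intro hsum
      by_contra hlt
      apply hBK
      intro v hv
      obtain ⟨j, hj, rfl, _⟩ := runs (E \ s) Finset.sdiff_subset hv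
      refine (cycle_mem_openCluster_iff ends L w e x E hw0 hwL hwinj he hE s hs hj).mpr ?_
      by_cases hjL : j = L
      · right; intro t ht1 ht2; omega
      · left; intro t ht1 ht2; exact hPspec t ht1 (by omega)
    have main := cycle_redBlue_flip ends L w e x E hw0 hwL hwinj he heinj hE s hs (P s) (Q s) hP1 hPL hPspec hP' hQ1 hQL hQspec hQ' hpq
      (φ s) rfl
    refine ⟨main, ?_⟩
    rcases Nat.lt_or_ge (P s + Q s) L with h | h
    · simp only [max_le_iff]; omega
    · have hpqL : P s + Q s = L := by
        have : P s + Q s ≤ L := by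
          by_contra h'
          exact hQspec (P s) (by omega) (by omega) (hPspec (P s) hP1 le_rfl)
        omega
      have := hpq hpqL
      simp only [max_le_iff]; omega
  -- injectivity of the flip on red–blue colourings
  have inj_rb : ∀ s s', s ⊆ E → s' ⊆ E → e 1 ∈ s → e L ∉ s → ¬ (K (E \ s) ⊆ K s) →
      e 1 ∈ s' → e L ∉ s' → ¬ (K (E \ s') ⊆ K s') → φ s = φ s' → s = s' := by
    intro s s' hs hs' h1 hL1 hBK h1' hL1' hBK' heq
    obtain ⟨⟨_, _, hpre, ⟨hr1, hr2⟩, _, _, _, hrec⟩, hrL⟩ := pack s hs h1 hL1 hBK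
    obtain ⟨⟨_, _, hpre', ⟨hr1', hr2'⟩, _, _, _, hrec'⟩, hrL'⟩ := pack s' hs' h1' hL1' hBK'
    rw [heq] at hpre hr1 hr2 hrec
    -- same prefix length
    have hPP : P s = P s' := by
      have a : P s ≤ P s' := (hpre' (P s) (by have := hrL; simp only [max_le_iff] at this; omega)).mp ((hpre (P s) (by have := hrL; simp only [max_le_iff] at this; omega)).mpr le_rfl)
      have b : P s' ≤ P s := (hpre (P s') (by have := hrL'; simp only [max_le_iff] at this; omega)).mp ((hpre' (P s') (by have := hrL'; simp only [max_le_iff] at this; omega)).mpr le_rfl)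
      omega
    -- same last blue edge
    have hRR : max (L - Q s) (P s + 1) = max (L - Q s') (P s' + 1) := by
      rcases lt_trichotomy (max (L - Q s) (P s + 1)) (max (L - Q s') (P s' + 1)) with h | h | h
      · exact absurd (hr2 _ h hrL') hr1'
      · exact h
      · exact absurd (hr2' _ h hrL) hr1
    -- recover the colourings
    ext i
    constructor
    · intro hi
      obtain ⟨t, ht1, ht2, rfl⟩ := (hE i).mp (hs hi)
      have := (hrec t ht1 ht2).mp hi
      rw [hRR, hPP] at this
      exact (hrec' t ht1 ht2).mpr this
    · intro hi
      obtain ⟨t, ht1, ht2, rfl⟩ := (hE i).mp (hs' hi)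
      have := (hrec' t ht1 ht2).mp hi
      rw [← hRR, ← hPP] at this
      exact (hrec t ht1 ht2).mpr this
  -- apply the domination-pairing principle
  refine tsum_nonneg_of_dominating_injection ends E x Ev Φ ?_ ?_ f g hf hg
  · intro s hs hKB hBK
    obtain ⟨hsE, hDs⟩ := (mem_Ev s).mp hs
    rcases mixed s hsE hKB hBK with ⟨h1, hL1⟩ | ⟨h1, hL1⟩
    · -- red–blue: the flip itself
      have hΦs : Φ s = φ s := by simp only [hΦ, if_pos h1]
      obtain ⟨⟨hφE, _, _, _, hdom1, hdom2, hdom3, _⟩, _⟩ := pack s hsE h1 hL1 hBK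
      rw [hΦs]
      have hM : K (φ s) ∪ K (E \ φ s) ⊆ K s ∪ K (E \ s) := by
        rintro v (hv | hv)
        · exact hdom2 hv
        · rw [Set.mem_singleton_iff.mp (hdom3 hv)]; exact Or.inl (hxK s)
      have hZ : K (φ s) ∩ K (E \ φ s) ⊆ K s ∩ K (E \ s) := by
        intro v hv; rw [Set.mem_singleton_iff.mp (hdom3 hv.2)]; exact ⟨hxK s, hxK (E \ s)⟩
      refine ⟨(mem_Ev _).mpr ⟨hφE, hD _ _ _ _ hDs hM hZ⟩, Or.inl ⟨hdom1, fun v hv => ?_⟩⟩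
      rw [Set.mem_singleton_iff.mp (hdom3 hv)]; exact ⟨hxK s, hxK (E \ s)⟩
    · -- blue–red: complement of the flip of the complement
      have hΦs : Φ s = E \ φ (E \ s) := by simp only [hΦ, if_neg h1]
      have h1' : e 1 ∈ E \ s := (memEs s 1 le_rfl (by omega)).mpr h1
      have hL1' : e L ∉ E \ s := fun h => (Finset.mem_sdiff.mp h).2 hL1
      have hBK' : ¬ (K (E \ (E \ s)) ⊆ K (E \ s)) := by rw [hEss s hsE]; exact hKB
      obtain ⟨⟨hφE, _, _, _, hdom1, hdom2, hdom3, _⟩, _⟩ := pack (E \ s) Finset.sdiff_subset h1' hL1' hBK'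
      rw [hEss s hsE] at hdom1 hdom2
      rw [hΦs]
      have hEE : E \ (E \ φ (E \ s)) = φ (E \ s) := hEss _ hφE
      have hM : K (E \ φ (E \ s)) ∪ K (E \ (E \ φ (E \ s))) ⊆ K s ∪ K (E \ s) := by
        rw [hEE]
        rintro v (hv | hv)
        · rw [Set.mem_singleton_iff.mp (hdom3 hv)]; exact Or.inl (hxK s)
        · rcases hdom2 hv with h' | h'
          · exact Or.inr h'
          · exact Or.inl h'
      have hZ : K (E \ φ (E \ s)) ∩ K (E \ (E \ φ (E \ s))) ⊆ K s ∩ K (E \ s) := by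
        intro v hv; rw [Set.mem_singleton_iff.mp (hdom3 hv.1)]; exact ⟨hxK s, hxK (E \ s)⟩
      refine ⟨(mem_Ev _).mpr ⟨Finset.sdiff_subset, hD _ _ _ _ hDs hM hZ⟩, Or.inr ⟨?_, fun v hv => ?_⟩⟩
      · rw [hEE]; intro v hv
        rcases hv with hv | hv
        · exact hdom1 (Or.inr hv)
        · exact hdom1 (Or.inl hv)
      · rw [Set.mem_singleton_iff.mp (hdom3 hv)]; exact ⟨hxK s, hxK (E \ s)⟩
  · intro s hs s' hs' hKB hBK hKB' hBK' heq
    obtain ⟨hsE, _⟩ := (mem_Ev s).mp hs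
    obtain ⟨hs'E, _⟩ := (mem_Ev s').mp hs'
    rcases mixed s hsE hKB hBK with ⟨h1, hL1⟩ | ⟨h1, hL1⟩ <;> rcases mixed s' hs'E hKB' hBK' with ⟨h1', hL1'⟩ | ⟨h1', hL1'⟩
    · have e1 : Φ s = φ s := by simp only [hΦ, if_pos h1]
      have e2 : Φ s' = φ s' := by simp only [hΦ, if_pos h1']
      rw [e1, e2] at heq
      exact inj_rb s s' hsE hs'E h1 hL1 hBK h1' hL1' hBK' heq
    · exfalso
      have e1 : Φ s = φ s := by simp only [hΦ, if_pos h1]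
      have e2 : Φ s' = E \ φ (E \ s') := by simp only [hΦ, if_neg h1']
      have hmem : e 1 ∈ Φ s := by rw [e1]; exact (pack s hsE h1 hL1 hBK).1.2.1
      rw [heq, e2] at hmem
      have h1'' : e 1 ∈ E \ s' := (memEs s' 1 le_rfl (by omega)).mpr h1'
      have hL1'' : e L ∉ E \ s' := fun h => (Finset.mem_sdiff.mp h).2 hL1'
      have hBK'' : ¬ (K (E \ (E \ s')) ⊆ K (E \ s')) := by rw [hEss s' hs'E]; exact hKB'
      exact (Finset.mem_sdiff.mp hmem).2 (pack (E \ s') Finset.sdiff_subset h1'' hL1'' hBK'').1.2.1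
    · exfalso
      have e1 : Φ s = E \ φ (E \ s) := by simp only [hΦ, if_neg h1]
      have e2 : Φ s' = φ s' := by simp only [hΦ, if_pos h1']
      have hmem : e 1 ∈ Φ s' := by rw [e2]; exact (pack s' hs'E h1' hL1' hBK').1.2.1
      rw [← heq, e1] at hmem
      have h1'' : e 1 ∈ E \ s := (memEs s 1 le_rfl (by omega)).mpr h1
      have hL1'' : e L ∉ E \ s := fun h => (Finset.mem_sdiff.mp h).2 hL1
      have hBK'' : ¬ (K (E \ (E \ s)) ⊆ K (E \ s)) := by rw [hEss s hsE]; exact hKB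
      exact (Finset.mem_sdiff.mp hmem).2 (pack (E \ s) Finset.sdiff_subset h1'' hL1'' hBK'').1.2.1
    · have e1 : Φ s = E \ φ (E \ s) := by simp only [hΦ, if_neg h1]
      have e2 : Φ s' = E \ φ (E \ s') := by simp only [hΦ, if_neg h1']
      rw [e1, e2] at heq
      have h1s : e 1 ∈ E \ s := (memEs s 1 le_rfl (by omega)).mpr h1
      have hL1s : e L ∉ E \ s := fun h => (Finset.mem_sdiff.mp h).2 hL1
      have hBKs : ¬ (K (E \ (E \ s)) ⊆ K (E \ s)) := by rw [hEss s hsE]; exact hKB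
      have h1s' : e 1 ∈ E \ s' := (memEs s' 1 le_rfl (by omega)).mpr h1'
      have hL1s' : e L ∉ E \ s' := fun h => (Finset.mem_sdiff.mp h).2 hL1'
      have hBKs' : ¬ (K (E \ (E \ s')) ⊆ K (E \ s')) := by rw [hEss s' hs'E]; exact hKB'
      have hφeq : φ (E \ s) = φ (E \ s') := by
        rw [← hEss _ (pack (E \ s) Finset.sdiff_subset h1s hL1s hBKs).1.1, heq,
          hEss _ (pack (E \ s') Finset.sdiff_subset h1s' hL1s' hBKs').1.1]
      have := inj_rb (E \ s) (E \ s') Finset.sdiff_subset Finset.sdiff_subset h1s hL1s hBKs h1s' hL1s' hBKs' hφeq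
      rw [← hEss s hsE, this, hEss s' hs'E]

end Coefficientwise


end Summit.CriticalPhenomena.PercolationContinuityZ3.Theorems
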